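import Summits.RiemannHypothesis.RiemannHypothesis.Theorems.SemilocalClassLawLeaves
import Summits.RiemannHypothesis.RiemannHypothesis.Theorems.WeilColumnCeilings
import HarnessLib

/-!
# C-I(a) — WHAT THE TAIL NEEDS, EXACTLY: the crux `SemilocalClassLawTail` from ANY RH-free wall ceiling below `1/(q+2)`, with explicit thresholds (RH-FREE; leaf currency — no import of `SemilocalClassLaw.lean`)

RH-FREE (LADDER-RH column WEIL, rung PROOF-OF-DATA, target (P2) C-I(a); cell `rh-explicit`; D-0040 / D-0059 / D-0061 route «WeilSemilocal» of planner
weil-routes-1; typing lane cc-s2-1, pen cc-s2-3).  HONEST FRAMING: statements about the tree's semi-local thresholds `a*(S_q) = weilSemilocalThreshold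
(Nat.primesBelow q)` and wall offsets `δ*(q) = wallOffset q = a*(S_q) − (log q)/2` of TRUNCATED Weil forms — UPPER clauses only; nothing here bears on
the truth of RH.  CURRENCY: the leaf file `SemilocalClassLawLeaves.lean` (p405674: `SemilocalClassLawAll`, `SemilocalClassLawTail`) and the upper
clause `UC(q) : a*(S_q) < (log q⁺)/2`; this module does NOT import the census-heavy `SemilocalClassLaw.lean` (director-rh I l.7233/7245), so it is
importable as soon as its two light parents are.  The head `q < 80` and `SemilocalClassLawTail → SemilocalClassLawAll` are `SemilocalClassLawHeadCert.lean`.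

* §1 SUFFICIENT, explicit: at an odd prime `q`, `δ*(q) < 1/(q+2)` ⟹ `δ*(q) < ½·log(1 + 2/q)` ⟹ `UC(q)` (since `q⁺ ≥ q + 2` and `1 − 1/x ≤ log x`);
  hence `(∀ primes q ≥ 80, δ*(q) < 1/(q+2)) → SemilocalClassLawTail`, and the same from any `q₀ ≥ 3` in `∀ q′` currency — NO `∃ q₁`.
  NECESSARY: `UC(q)` ⟹ `δ*(q) < (q⁺ − q)/(2q)` (`log x ≤ x − 1`), `< 1/q` at a twin prime — exponent `> 1` (or exponent `1`, constant `< 1`) is forced.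
* §2 THE COLUMN'S CEILINGS PLUG IN (`WeilColumnCeilings.lean`, cc-s2-3 p404930; `HandoffDodgerCeiling.lean`, prove-2): ANY scale with `s(q) < 1/(q+2)`
  from `q₀ ≥ 3` gives the law from `q₀`; the one-constant scale `c/(2 q^{3/2} log q)` does for every `c ≤ 2`, the Dodger scale `C (log q)^{3/2} q^{−3/2}`
  for every `0 ≤ C ≤ 1/10` (prove-2's `7/100`), both from `q = 3`; so `OneConstantWallCeiling c 80` (`c ≤ 2`) or `DodgerWallCeiling C 80` (`C ≤ 1/10`)
  ⟹ `SemilocalClassLawTail`.  (prove-2's `WeilColumnDodgerLeaf.lean`, p407907, PROVES `DodgerWallCeiling (7/100) ⌈e^204⌉` and the tail beyond `⌈e^204⌉`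
  by the zero-sum route; §2 is the scale comparison usable with ANY future `(C, q₀)`.)
References: H. Yoshida, Adv. Stud. Pure Math. 21 (1992) Prop. 6 p. 320 (`Yoshida1992HermitianForms`); A. Connes, C. Consani, Enseign. Math. 69 (2023)
§2.1.2 (`ConnesConsani2023`).  Elementary consequences of the definitions; not in print (the objects are the cell's).
-/

set_option linter.dupNamespace false  -- the mandated namespace repeats `RiemannHypothesis`

noncomputable section

open Set Literature.NumberTheory.LFunctions
open Summit.RiemannHypothesis.RiemannHypothesis.Theorems
open Summit.RiemannHypothesis.RiemannHypothesis.Theorems.HandoffDecomposition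
open Summit.RiemannHypothesis.RiemannHypothesis.Theorems.HandoffMarginLaw (wallOffset)
open Summit.RiemannHypothesis.RiemannHypothesis.Theorems.MotivicDoor.SemilocalThreshold

namespace Summit.RiemannHypothesis.RiemannHypothesis.Theorems.SemilocalClassLaw

/-! ## §1  What the tail needs, exactly: `δ*(q) < 1/(q+2)` suffices for `UC(q)`, `δ*(q) < (q⁺ − q)/(2q)` is necessary -/

/-- For an odd prime `q`, `q + 2 ≤ q⁺` (the successor of an odd prime is even). [folklore] -/
theorem add_two_le_nextPrime {q : ℕ} (hq : q.Prime) (h3 : 3 ≤ q) : q + 2 ≤ nextPrime q := by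
  by_contra h
  have h1 : nextPrime q = q + 1 := by have := lt_nextPrime q; omega
  have hodd : ¬ 2 ∣ q := fun hd ↦ by
    have := (Nat.prime_dvd_prime_iff_eq Nat.prime_two hq).1 hd; omega
  have h2 : 2 ∣ q + 1 := by omega
  have hp := nextPrime_prime q
  rw [h1] at hp
  have := (Nat.prime_dvd_prime_iff_eq Nat.prime_two hp).1 h2
  omega

/-- `1/(q+2) ≤ ½·log(1 + 2/q)` (`1 − 1/x ≤ log x` at `x = 1 + 2/q`). [folklore] -/
theorem inv_add_two_le_log_one_add_half {q : ℕ} (hq : 0 < q) :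
    (1 : ℝ) / (q + 2) ≤ Real.log (1 + 2 / q) / 2 := by
  have hq0 : (0 : ℝ) < q := by exact_mod_cast hq
  have h := Real.one_sub_inv_le_log_of_pos (x := 1 + 2 / (q : ℝ)) (by positivity)
  have e : (1 : ℝ) - (1 + 2 / (q : ℝ))⁻¹ = 2 / (q + 2) := by
    field_simp
    ring
  rw [e] at h
  have e2 : (1 : ℝ) / (q + 2) = 2 / (q + 2) / 2 := by ring
  rw [e2]
  linarith

/-- **SUFFICIENT (log form)**: at an odd prime `q`, `δ*(q) < ½·log(1 + 2/q)` ⟹ `UC(q) : a*(S_q) < (log q⁺)/2`. [this cell (HANDOFF track), HOME/STRUCTURE.md §2 C-I(a)] -/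
theorem upperClause_of_wallOffset_lt_log_one_add {q : ℕ} (hq : q.Prime) (h3 : 3 ≤ q)
    (h : wallOffset q < Real.log (1 + 2 / q) / 2) :
    weilSemilocalThreshold (Nat.primesBelow q) < Real.log (nextPrime q) / 2 := by
  have hq0 : (0 : ℝ) < q := by exact_mod_cast hq.pos
  have h1 : Real.log (1 + 2 / q) = Real.log ((q : ℝ) + 2) - Real.log q := by
    rw [← Real.log_div (by positivity) hq0.ne']
    congr 1
    field_simp
  have h2 : (q : ℝ) + 2 ≤ nextPrime q := by exact_mod_cast add_two_le_nextPrime hq h3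
  have h4 := Real.log_le_log (by positivity) h2
  unfold wallOffset at h
  rw [h1] at h
  linarith

/-- **SUFFICIENT (rational form)**: at an odd prime `q`, `δ*(q) < 1/(q+2)` ⟹ `UC(q)`. [this cell (HANDOFF track), HOME/STRUCTURE.md §2 C-I(a)] -/
theorem upperClause_of_wallOffset_lt_inv_add_two {q : ℕ} (hq : q.Prime) (h3 : 3 ≤ q) (h : wallOffset q < 1 / (q + 2)) :
    weilSemilocalThreshold (Nat.primesBelow q) < Real.log (nextPrime q) / 2 :=
  upperClause_of_wallOffset_lt_log_one_add hq h3 (lt_of_lt_of_le h (inv_add_two_le_log_one_add_half hq.pos))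

/-- The same in the leaf's `∀ q′` currency: `δ*(q) < 1/(q+2)` ⟹ `∀ primes q′ > q, a*(S_q) < (log q′)/2`. [this cell, HOME/STRUCTURE.md §2 C-I(a)] -/
theorem forall_clause_of_wallOffset_lt_inv_add_two {q : ℕ} (hq : q.Prime) (h3 : 3 ≤ q) (h : wallOffset q < 1 / (q + 2)) :
    ∀ q' : ℕ, q'.Prime → q < q' → weilSemilocalThreshold (Nat.primesBelow q) < Real.log q' / 2 :=
  forall_prime_gt_lt_iff_upperClause.2 (upperClause_of_wallOffset_lt_inv_add_two hq h3 h)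

/-- **The explicit-threshold tail**: for `q₀ ≥ 3`, `(∀ primes q ≥ q₀, δ*(q) < 1/(q+2))` ⟹ C-I(a) at every prime `q ≥ q₀` — NO `∃ q₁`. [this cell (HANDOFF track), HOME/STRUCTURE.md §2 C-I(a)] -/
theorem forall_from_of_wallOffset_lt_inv_add_two {q₀ : ℕ} (h3 : 3 ≤ q₀)
    (h : ∀ q : ℕ, q.Prime → q₀ ≤ q → wallOffset q < 1 / (q + 2)) :
    ∀ q : ℕ, q.Prime → q₀ ≤ q → ∀ q' : ℕ, q'.Prime → q < q' → weilSemilocalThreshold (Nat.primesBelow q) < Real.log q' / 2 :=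
  fun q hq hle ↦ forall_clause_of_wallOffset_lt_inv_add_two hq (h3.trans hle) (h q hq hle)

/-- **The crux from the rational sufficient bound**: `(∀ primes q ≥ 80, δ*(q) < 1/(q+2)) → SemilocalClassLawTail`. [this cell (HANDOFF track), HOME/STRUCTURE.md §2 C-I(a)] -/
theorem semilocalClassLawTail_of_wallOffset_lt_inv_add_two
    (h : ∀ q : ℕ, q.Prime → 80 ≤ q → wallOffset q < 1 / (q + 2)) : SemilocalClassLawTail :=
  forall_from_of_wallOffset_lt_inv_add_two (by norm_num) h

/-- **NECESSARY**: `UC(q)` at a prime `q` forces `δ*(q) < (q⁺ − q)/(2q)` (`log x ≤ x − 1`); so along twin primes the law demands `δ*(q) < 1/q` —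
no ceiling with exponent `≤ 1` and constant `≥ 1` can carry the tail. [this cell (HANDOFF track), HOME/STRUCTURE.md §2 C-I(a)] -/
theorem wallOffset_lt_of_upperClause {q : ℕ} (hq : q.Prime)
    (h : weilSemilocalThreshold (Nat.primesBelow q) < Real.log (nextPrime q) / 2) :
    wallOffset q < ((nextPrime q : ℝ) - q) / (2 * q) := by
  have hq0 : (0 : ℝ) < q := by exact_mod_cast hq.pos
  have hn0 : (0 : ℝ) < nextPrime q := by exact_mod_cast (nextPrime_prime q).pos
  have h1 : Real.log (nextPrime q) - Real.log q = Real.log ((nextPrime q : ℝ) / q) := (Real.log_div hn0.ne' hq0.ne').symm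
  have h2 : Real.log ((nextPrime q : ℝ) / q) ≤ (nextPrime q : ℝ) / q - 1 := Real.log_le_sub_one_of_pos (by positivity)
  have h5 : ((nextPrime q : ℝ) - q) / (2 * q) = ((nextPrime q : ℝ) / q - 1) / 2 := by
    field_simp
  unfold wallOffset
  rw [h5]
  linarith

/-- At a twin prime (`q⁺ = q + 2`) the law needs `δ*(q) < 1/q`. [this cell (HANDOFF track), HOME/STRUCTURE.md §2 C-I(a)] -/
theorem wallOffset_lt_inv_of_twin_of_upperClause {q : ℕ} (hq : q.Prime) (htwin : nextPrime q = q + 2)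
    (h : weilSemilocalThreshold (Nat.primesBelow q) < Real.log (nextPrime q) / 2) : wallOffset q < 1 / q := by
  have h1 := wallOffset_lt_of_upperClause hq h
  have hq0 : (0 : ℝ) < q := by exact_mod_cast hq.pos
  rw [htwin, Nat.cast_add, Nat.cast_two, show ((q : ℝ) + 2 - q) / (2 * q) = 1 / q by field_simp; ring] at h1
  exact h1

/-- The crux in the necessary direction: `SemilocalClassLawTail` ⟹ `δ*(q) < (q⁺ − q)/(2q)` for every prime `q ≥ 80`. [this cell, HOME/STRUCTURE.md §2 C-I(a)] -/
theorem wallOffset_lt_of_semilocalClassLawTail (h : SemilocalClassLawTail) {q : ℕ} (hq : q.Prime) (h80 : 80 ≤ q) :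
    wallOffset q < ((nextPrime q : ℝ) - q) / (2 * q) :=
  wallOffset_lt_of_upperClause hq ((semilocalClassLawTail_iff_forall_upperClause.1 h) q hq h80)

/-! ## §2  The column's RH-free ceilings plug in: ANY scale below `1/(q+2)` gives the law from an explicit prime -/

/-- **Generic, explicit threshold**: a wall ceiling `δ*(q) ≤ s(q)` at ANY scale with `s(q) < 1/(q+2)` on the primes `q ≥ q₀ ≥ 3` gives C-I(a)
at every prime `q ≥ q₀` — no `∃ q₁`, no exponent-`3/2` detour. [this cell (HANDOFF track); WeilColumnCeilings (cc-s2-3) for `WallCeilingAtScale`] -/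
theorem forall_from_of_wallCeilingAtScale {s : ℕ → ℝ} {q₀ : ℕ} (h3 : 3 ≤ q₀) (hs : WeilColumn.WallCeilingAtScale s q₀)
    (hsmall : ∀ q : ℕ, q.Prime → q₀ ≤ q → s q < 1 / ((q : ℝ) + 2)) :
    ∀ q : ℕ, q.Prime → q₀ ≤ q → ∀ q' : ℕ, q'.Prime → q < q' → weilSemilocalThreshold (Nat.primesBelow q) < Real.log q' / 2 :=
  forall_from_of_wallOffset_lt_inv_add_two h3 fun q hq hle ↦ (hs q hq hle).trans_lt (hsmall q hq hle)

/-- The one-constant scale is below `1/(q+2)` at every `q ≥ 3` once `c ≤ 2`: `c/(2 q^{3/2} log q) < 1/(q+2)` (`√q ≥ 17/10`, `log q ≥ 1`). [folklore] -/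
theorem oneConstantScale_lt_inv_add_two {c : ℝ} (hc : c ≤ 2) {q : ℕ} (hq : 3 ≤ q) :
    WeilColumn.oneConstantScale c q < 1 / ((q : ℝ) + 2) := by
  unfold WeilColumn.oneConstantScale
  have hq3 : (3 : ℝ) ≤ q := by exact_mod_cast hq
  have hq0 : (0 : ℝ) < q := by linarith
  have hlog : 1 ≤ Real.log q := by
    rw [← Real.log_exp 1]
    exact Real.log_le_log (Real.exp_pos 1) (le_trans (le_of_lt (lt_trans Real.exp_one_lt_d9 (by norm_num))) hq3)
  have hs3 : (17 / 10 : ℝ) ≤ Real.sqrt q := by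
    rw [Real.le_sqrt (by norm_num) hq0.le]
    nlinarith
  have hrpow : (q : ℝ) ^ (3 / 2 : ℝ) = q * Real.sqrt q := by
    rw [show (3 / 2 : ℝ) = 1 + 1 / 2 by norm_num, Real.rpow_add hq0, Real.rpow_one, Real.sqrt_eq_rpow]
  rw [hrpow]
  have hD : (17 / 5 : ℝ) * q ≤ 2 * (q * Real.sqrt q) * Real.log q := by
    have h1 : (17 / 10 : ℝ) * q ≤ q * Real.sqrt q := by nlinarith
    have h2 : 0 ≤ 2 * (q * Real.sqrt q) := by positivity
    nlinarith
  have hDpos : 0 < 2 * (q * Real.sqrt q) * Real.log q := by nlinarith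
  rw [div_lt_div_iff₀ hDpos (by positivity)]
  nlinarith

/-- **(C) branch with ANY `c ≤ 2`** (DATA of the column: `c₀ ≈ 0.09`): `OneConstantWallCeiling c q₀`, `q₀ ≥ 3` ⟹ C-I(a) at every prime `q ≥ q₀`. [this cell; WeilColumnCeilings (cc-s2-3) for the target] -/
theorem forall_from_of_oneConstantWallCeiling {c : ℝ} {q₀ : ℕ} (h3 : 3 ≤ q₀) (hc : c ≤ 2) (h : WeilColumn.OneConstantWallCeiling c q₀) :
    ∀ q : ℕ, q.Prime → q₀ ≤ q → ∀ q' : ℕ, q'.Prime → q < q' → weilSemilocalThreshold (Nat.primesBelow q) < Real.log q' / 2 :=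
  forall_from_of_wallCeilingAtScale h3 h fun _ _ hle ↦ oneConstantScale_lt_inv_add_two hc (h3.trans hle)

/-- **CLOSING SCHEMA (C branch) for the crux**: `OneConstantWallCeiling c 80` with any `c ≤ 2` ⟹ `SemilocalClassLawTail`. [this cell; WeilColumnCeilings for the target] -/
theorem semilocalClassLawTail_of_oneConstantWallCeiling {c : ℝ} (hc : c ≤ 2) (h : WeilColumn.OneConstantWallCeiling c 80) : SemilocalClassLawTail :=
  forall_from_of_oneConstantWallCeiling (by norm_num) hc h

/-- prove-2's Dodger scale is below `1/(q+2)` for `q ≥ 3` once `0 ≤ C ≤ 1/10`: `C·(log q)^{3/2}·q^{−3/2} < 1/(q+2)`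
(`log q ≤ 3 q^{1/3}`, `3^{3/2} < 26/5` — cf. `HandoffCeilingRateSmallC.three_rpow_three_halves_lt`). [folklore] -/
theorem dodgerScale_lt_inv_add_two {C : ℝ} (hC0 : 0 ≤ C) (hC : C ≤ 1 / 10) {q : ℕ} (hq : 3 ≤ q) :
    C * Real.log q ^ (3 / 2 : ℝ) * (q : ℝ) ^ (-(3 / 2 : ℝ)) < 1 / ((q : ℝ) + 2) := by
  have hq3 : (3 : ℝ) ≤ q := by exact_mod_cast hq
  have hq0 : (0 : ℝ) < q := by linarith
  have hL0 : 0 ≤ Real.log q := Real.log_nonneg (by linarith)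
  have hlog : Real.log q ≤ 3 * (q : ℝ) ^ (1 / 3 : ℝ) := by
    have h := Real.log_le_rpow_div hq0.le (show (0 : ℝ) < 1 / 3 by norm_num)
    have e : (q : ℝ) ^ (1 / 3 : ℝ) / (1 / 3) = 3 * (q : ℝ) ^ (1 / 3 : ℝ) := by ring
    rw [e] at h; exact h
  have hpow : Real.log q ^ (3 / 2 : ℝ) ≤ (3 : ℝ) ^ (3 / 2 : ℝ) * Real.sqrt q := by
    have h1 : Real.log q ^ (3 / 2 : ℝ) ≤ (3 * (q : ℝ) ^ (1 / 3 : ℝ)) ^ (3 / 2 : ℝ) :=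
      Real.rpow_le_rpow hL0 hlog (by norm_num)
    have h2 : (3 * (q : ℝ) ^ (1 / 3 : ℝ)) ^ (3 / 2 : ℝ) = (3 : ℝ) ^ (3 / 2 : ℝ) * Real.sqrt q := by
      rw [Real.mul_rpow (by norm_num) (Real.rpow_nonneg hq0.le _), ← Real.rpow_mul hq0.le,
        show (1 / 3 : ℝ) * (3 / 2) = 1 / 2 by norm_num, Real.sqrt_eq_rpow]
    rw [h2] at h1; exact h1
  have h3 : (3 : ℝ) ^ (3 / 2 : ℝ) < 26 / 5 := by  -- also `HandoffCeilingRateSmallC.three_rpow_three_halves_lt`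
    have e : (3 : ℝ) ^ (3 / 2 : ℝ) = 3 * Real.sqrt 3 := by
      rw [show (3 / 2 : ℝ) = 1 + 1 / 2 by norm_num, Real.rpow_add (by norm_num), Real.rpow_one, Real.sqrt_eq_rpow]
    have hs : Real.sqrt 3 < 1733 / 1000 := by
      rw [Real.sqrt_lt' (by norm_num)]; norm_num
    rw [e]; nlinarith
  have hsq0 : 0 < Real.sqrt q := Real.sqrt_pos.2 hq0
  have hneg : (q : ℝ) ^ (-(3 / 2 : ℝ)) = ((q : ℝ) * Real.sqrt q)⁻¹ := by
    rw [Real.rpow_neg hq0.le, show (3 / 2 : ℝ) = 1 + 1 / 2 by norm_num, Real.rpow_add hq0, Real.rpow_one,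
      Real.sqrt_eq_rpow]
  rw [hneg]
  have hD : 0 < (q : ℝ) * Real.sqrt q := by positivity
  rw [← div_eq_mul_inv, div_lt_div_iff₀ hD (by positivity)]
  have hCL : C * Real.log q ^ (3 / 2 : ℝ) ≤ (1 / 10) * ((26 / 5) * Real.sqrt q) := by
    have : Real.log q ^ (3 / 2 : ℝ) ≤ (26 / 5) * Real.sqrt q := by nlinarith [Real.rpow_nonneg hL0 (3 / 2 : ℝ)]
    have hp : 0 ≤ Real.log q ^ (3 / 2 : ℝ) := Real.rpow_nonneg hL0 _
    nlinarith
  nlinarith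

/-- **prove-2's typed (P1) target with an EXPLICIT threshold**: `DodgerWallCeiling C q₀` with `0 ≤ C ≤ 1/10` (prove-2's working constant is `7/100`)
and `q₀ ≥ 3` ⟹ C-I(a) at every prime `q ≥ q₀`. [this cell (HANDOFF track); HandoffDodgerCeiling (prove-2) for the target] -/
theorem forall_from_of_dodgerWallCeiling {C : ℝ} {q₀ : ℕ} (h3 : 3 ≤ q₀) (hC0 : 0 ≤ C) (hC : C ≤ 1 / 10)
    (h : Handoff.DodgerWallCeiling C q₀) :
    ∀ q : ℕ, q.Prime → q₀ ≤ q → ∀ q' : ℕ, q'.Prime → q < q' → weilSemilocalThreshold (Nat.primesBelow q) < Real.log q' / 2 :=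
  forall_from_of_wallOffset_lt_inv_add_two h3 fun q hq hle ↦
    (h q hq hle).trans_lt (dodgerScale_lt_inv_add_two hC0 hC (h3.trans hle))

/-- **CLOSING SCHEMA (prove-2's P1) for the crux**: `DodgerWallCeiling C 80` with `0 ≤ C ≤ 1/10` ⟹ `SemilocalClassLawTail`. [this cell; HandoffDodgerCeiling for the target] -/
theorem semilocalClassLawTail_of_dodgerWallCeiling {C : ℝ} (hC0 : 0 ≤ C) (hC : C ≤ 1 / 10) (h : Handoff.DodgerWallCeiling C 80) :
    SemilocalClassLawTail :=
  forall_from_of_dodgerWallCeiling (by norm_num) hC0 hC h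

end Summit.RiemannHypothesis.RiemannHypothesis.Theorems.SemilocalClassLaw

end
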